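import Summits.AnomalousDissipation.AnomalousDissipation.Theses.Sparks
import Literature.Analysis.FluidPDE.DissipationAnomalyProofs

/-!
# Crux `SingularitiesDissipate` (stmt-AnomalousDissipation-1185, route Sparks, rank 3) — line `robust` (crux-strategist, 2026-08-17)

An ALTERNATIVE skeleton for the crux (the live skeleton `Lines/birth.lean` is untouched). Birth cuts the CONCLUSION of the
crux (LIFESPAN ∣ DRAIN ∣ VISCOUS); `robust` cuts the HYPOTHESIS and the DATA, so that the single open analytic stub is stated in
its cleanest form — smooth data inside an `L²`-ROBUST blow-up ball — and the two reductions in front of it are typed: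

* `stub_blowupIsL2Open` (OPEN, pure Euler; = child 1 of the strategist's split, `Cruxes/SingularitiesDissipate/SplitGlue.lean`):
  a `C^∞` breakdown of smooth steadily-forced Euler at ONE smooth datum `U₀` by time `T` is a breakdown on a whole `L²`-BALL of
  smooth divergence-free data around `U₀` by `T + τ`. NECESSARY for the crux as typed (`blowupIsL2Open_of_singularitiesDissipate`,
  proved there modulo the route's support `WindowStability`): every proof of the crux proves this stub implicitly (birth hides it
  inside `stub_blowupDrainsEnergy`, whose `∀ δ-close data` forbids defusing perturbations). Refuter-first: Vasseur–Vishik 2020 Cor. 1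
  (blow-ups are hydrodynamically unstable in every `L^p`).
* `stub_regularRestart` (KNOWN MATHEMATICS, size XL in Lean): Leray's epochs of regularity + restart for the tree's Leray–Hopf
  class on `T³` with steady smooth force. Every global Leray–Hopf solution `u` (fixed `ν > 0`, finite-energy datum `u₀`) has, in
  every initial time interval `(0, s₀)`, a time `s` and a SMOOTH divergence-free field `V`, `ε`-close to `u₀` in `L²`, such that
  `t ↦ u (s + t)` is a global Leray–Hopf solution from `V` (so `V = u(s)` a.e. by `strong_initial`; the stub asks for a smooth
  REPRESENTATIVE, never for pointwise smoothness of the slice `u s`, which the integral-only structure `Torus.IsLerayHopfOn` cannot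
  see — the junk-representative trap of the 2026-08-15 review in another guise). Why true: the strong energy inequality
  `energy_ineq_ae` puts `u(s) ∈ H¹` for a.e. `s`; from such `s` a strong solution exists locally and coincides with `u` by
  weak–strong uniqueness in the class (Sather–Serrin), and is `C^∞` in space for `t > s` (smooth force); regular times are
  therefore dense (the singular set is closed of `H^{1/2}`-measure zero) and can be taken among the a.e. good times of
  `energy_ineq_ae`; restart = the weak formulation cut at `s` by weak continuity + the energy inequalities from `s`;
  `ε`-closeness from `strong_initial`. Leray 1934 §§31–34; Galdi 2000 §§4–5; Robinson–Rodrigo–Sadowski 2016 Thm 8.14–8.17.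
* `stub_smoothBallIgnition` (OPEN — the Onsager core, load-bearing): if EVERY smooth divergence-free `V` in the closed `L²`-ball
  of radius `r` about `U₀` fails to launch a classical forced-Euler solution on `[0, S]`, then `∃ q τ ν₀ δ` such that every
  global Leray–Hopf solution of `NS_ν`, `ν < ν₀`, from a SMOOTH divergence-free datum `V` with `‖V − U₀‖₂ ≤ δ` burns
  `q ≤ ν ∫_{(0,S+τ)} eGradNormSq (u t)`. Strictly weaker than the split's child `BallIgnition` (smooth data only) and than the
  crux (ball hypothesis); birth's cut DRAIN ∣ VISCOUS applies to it verbatim as helper lemmas. Why it might fail: the crux's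
  own Onsager bet — escape below the dissipation wavenumber without burn for the whole delay (Cheskidov 2023 Thm 2.1/2.5), mild
  Onsager-subcritical continuation, Leray–Hopf slack.

Composition `SingularitiesDissipate_of : stub₁ → stub₂ → stub₃ → SingularitiesDissipate` (kernel-checked, no sorry of its own):
breakdown at `U₀` by `T` ⇒ (stub 1) blow-up ball `B_r(U₀)` by `T+τ₁` ⇒ (stub 3 at `r`, `S := T+τ₁`) `q, τ₂, ν₀, δ` for smooth
data in `B_δ(U₀)` ⇒ for a rough datum `u₀ ∈ B_{δ/2}(U₀)` and any global LH `u`: (stub 2 with `s₀ := 1`, `ε := δ/2`) a restart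
time `s ∈ (0,1)` with smooth datum `V ∈ B_δ(U₀)` (triangle inequality in `L²`) ⇒ `q ≤ ν∫_{(0,S+τ₂)} eGradNormSq (u (s+t)) dt
= ν∫_{(s, s+S+τ₂)} eGradNormSq (u t) dt` (translation invariance of Lebesgue measure) `≤ ν∫_{(0, T+(τ₁+τ₂+1))}` (monotonicity of
the window; finiteness by `IsLerayHopfOn.lintegral_eGradNormSq_lt_top`). Witnesses `(q, τ₁+τ₂+1, ν₀, δ/2)`.

Registration note: this CLI has no `skeleton check --alt`; to keep the live skeleton pointer on `Lines/birth.lean` the stubs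
of this line are NOT registered by the strategist — a lead switching to `robust` at a cycle boundary runs
`ledger skeleton check $(ledger crux dir stmt-AnomalousDissipation-1185)/Lines/robust.lean --crux stmt-AnomalousDissipation-1185`
(self-audit with `#h21_check_skeleton` recorded in `Lines/robust.md`).

Disproof used: none relevant (no Disproof.lean on the crux, 2026-08-17). Negatives honoured: 2859 (junk `t = 0` slice) — all
burns are integrals over open windows, restart data enter only through `L²` quantities; no stub is an instance of a refuted
statement (14324, 0204, 13037, 2979, 2984, 2859 concern 2½-D lifts, correlation energies, Taylor certificates, energy ceilings,
debris quanta).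
-/

set_option linter.dupNamespace false

noncomputable section

open Filter Set MeasureTheory Topology

namespace Summit.AnomalousDissipation.AnomalousDissipation.Cruxes.SingularitiesDissipate.Robust

/-- **stub 1 — BREAKDOWN IS `L²`-ROBUST WITH DELAY (open, pure Euler; child 1 of the strategist's split).** See the module
docstring. Necessary for the crux as typed (`SplitGlue.blowupIsL2Open_of_singularitiesDissipate`, mod `WindowStability`).
Why it might fail: blow-up solutions of 3-D Euler are linearly unstable in every `L^p` (Vasseur–Vishik 2020 Cor. 1), so
`L²`-small `C¹`-large perturbations may launch classical solutions living past `T + τ`; nonlinear stability of blow-up is known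
only in strong weighted norms (Elgindi–Ghoul–Masmoudi 2021). Sources: VasseurVishik2020; ElgindiGhoulMasmoudi2021;
BrueDeLellis2023 §1. -/
theorem stub_blowupIsL2Open :
    ∀ f : UnitAddTorus (Fin 3) → EuclideanSpace ℝ (Fin 3), Literature.Analysis.FunctionSpaces.Torus.IsSmooth f → Literature.Analysis.FunctionSpaces.Torus.IsDivFree f → Literature.Analysis.FunctionSpaces.Torus.HasZeroMean f → ∀ (U₀ : UnitAddTorus (Fin 3) → EuclideanSpace ℝ (Fin 3)), Literature.Analysis.FunctionSpaces.Torus.IsSmooth U₀ → Literature.Analysis.FunctionSpaces.Torus.IsDivFree U₀ → ∀ (T : ℝ), 0 < T → (∀ (U : ℝ → UnitAddTorus (Fin 3) → EuclideanSpace ℝ (Fin 3)) (P : ℝ → UnitAddTorus (Fin 3) → ℝ), Literature.Analysis.FunctionSpaces.Torus.IsClassicalNSSolutionOn (Set.Icc 0 T) 0 (fun _ => f) U P → U 0 ≠ U₀) → ∃ (τ r : ℝ), 0 ≤ τ ∧ 0 < r ∧ ∀ (V : UnitAddTorus (Fin 3) → EuclideanSpace ℝ (Fin 3)), Literature.Analysis.FunctionSpaces.Torus.IsSmooth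 V → Literature.Analysis.FunctionSpaces.Torus.IsDivFree V → MeasureTheory.eLpNorm (V - U₀) 2 MeasureTheory.volume ≤ ENNReal.ofReal r → ∀ (U : ℝ → UnitAddTorus (Fin 3) → EuclideanSpace ℝ (Fin 3)) (P : ℝ → UnitAddTorus (Fin 3) → ℝ), Literature.Analysis.FunctionSpaces.Torus.IsClassicalNSSolutionOn (Set.Icc 0 (T + τ)) 0 (fun _ => f) U P → U 0 ≠ V := by
  sorry

/-- **stub 2 — REGULAR RESTART WITH A SMOOTH REPRESENTATIVE (known mathematics: Leray's epochs of regularity + restart for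
the tree's Leray–Hopf class on `T³`, steady smooth force; size XL).** For every viscosity `ν > 0`, every smooth steady force
`f`, every global Leray–Hopf solution `u` from a finite-energy datum `u₀`, every `s₀ > 0` and `ε > 0` there are a time
`s ∈ (0, s₀)` and a SMOOTH divergence-free field `V` with `‖V − u₀‖_{L²} ≤ ε` such that `t ↦ u (s + t)` is a global
Leray–Hopf solution forced by `f` from the datum `V` (hence `V = u s` almost everywhere, by `strong_initial`). The smooth
representative `V` (rather than `IsSmooth (u s)`) is essential: `Torus.IsLerayHopfOn` constrains slices only through
integrals. Sources: Leray1934 §§31–34; Galdi2000 §§4–5; RobinsonRodrigoSadowski2016 Ch. 8; Hopf1951. -/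
theorem stub_regularRestart :
    ∀ (ν : ℝ), 0 < ν → ∀ f : UnitAddTorus (Fin 3) → EuclideanSpace ℝ (Fin 3), Literature.Analysis.FunctionSpaces.Torus.IsSmooth f → Literature.Analysis.FunctionSpaces.Torus.IsDivFree f → Literature.Analysis.FunctionSpaces.Torus.HasZeroMean f → ∀ (u₀ : UnitAddTorus (Fin 3) → EuclideanSpace ℝ (Fin 3)) (u : ℝ → UnitAddTorus (Fin 3) → EuclideanSpace ℝ (Fin 3)), Literature.Analysis.FluidPDE.Torus.IsGlobalLerayHopf ν (fun _ => f) u₀ u → MeasureTheory.MemLp u₀ 2 MeasureTheory.volume → ∀ (s₀ ε : ℝ), 0 < s₀ → 0 < ε → ∃ (s : ℝ) (V : UnitAddTorus (Fin 3) → EuclideanSpace ℝ (Fin 3)), 0 < s ∧ s < s₀ ∧ Literature.Analysis.FunctionSpaces.Torus.IsSmooth V ∧ Literature.Analysis.FunctionSpaces.Torus.IsDivFree V ∧ MeasureTheory.eLpNorm (V - u₀) 2 MeasureTheory.volume ≤ ENNReal.ofReal ε ∧ Literature.Analysis.FluidPDE.Torus.IsGlobalLerayHopf ν (fun _ => f)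 V (fun t => u (s + t)) := by
  sorry

/-- **stub 3 — SMOOTH DATA IN A ROBUST BLOW-UP BALL IGNITE (open; the Onsager core; load-bearing).** For a smooth steady
div-free mean-zero `f`, a smooth div-free `U₀`, `r > 0`, `S > 0`: if every smooth div-free `V` with `‖V − U₀‖₂ ≤ r` fails to
launch a classical forced-Euler solution on `[0, S]`, then there are `q > 0`, `τ ≥ 0`, `ν₀ > 0`, `δ > 0` such that every global
Leray–Hopf solution `u` of `NS_ν`, `0 < ν < ν₀`, forced by `f`, from a SMOOTH div-free datum `V` with `‖V − U₀‖₂ ≤ δ` burns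
`q ≤ ν ∫_{(0,S+τ)} eGradNormSq (u t)`. Why plausibly true / why it might fail: exactly the crux's Onsager bet (a robust
smooth-data singularity of steadily forced 3-D Euler cascades a `ν`-independent quantum into the dissipation range within a
fixed delay — Onsager 1949 — versus escape below the dissipation wavenumber without burn, Cheskidov 2023 Thm 2.1/2.5, mild
Onsager-subcritical continuation, or Leray–Hopf slack), MINUS defusing perturbations (excluded by the ball hypothesis) and
MINUS rough data (stub 2). Birth's DRAIN ∣ VISCOUS cut applies verbatim as helpers. Sources: Cheskidov2023 Thm 2.1/2.5;
DrivasEyink2019 Thm 2; Onsager1949; BrueDeLellis2023 §1, App. Lemma 7; Constantin1986 Thm 1.1; CheskidovFriedlander2009 Thm 4.2. -/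
theorem stub_smoothBallIgnition :
    ∀ f : UnitAddTorus (Fin 3) → EuclideanSpace ℝ (Fin 3), Literature.Analysis.FunctionSpaces.Torus.IsSmooth f → Literature.Analysis.FunctionSpaces.Torus.IsDivFree f → Literature.Analysis.FunctionSpaces.Torus.HasZeroMean f → ∀ (U₀ : UnitAddTorus (Fin 3) → EuclideanSpace ℝ (Fin 3)), Literature.Analysis.FunctionSpaces.Torus.IsSmooth U₀ → Literature.Analysis.FunctionSpaces.Torus.IsDivFree U₀ → ∀ (r S : ℝ), 0 < r → 0 < S → (∀ (V : UnitAddTorus (Fin 3) → EuclideanSpace ℝ (Fin 3)), Literature.Analysis.FunctionSpaces.Torus.IsSmooth V → Literature.Analysis.FunctionSpaces.Torus.IsDivFree V → MeasureTheory.eLpNorm (V - U₀) 2 MeasureTheory.volume ≤ ENNReal.ofReal r → ∀ (U : ℝ → UnitAddTorus (Fin 3) → EuclideanSpace ℝ (Fin 3)) (P : ℝ → UnitAddTorus (Fin 3) → ℝ), Literature.Analysis.FunctionSpaces.Torus.IsClassicalNSSolutionOn (Set.Icc 0 S) 0 (fun _ => f) U P → U 0 ≠ V) → ∃ (q τ ν₀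 δ : ℝ), 0 < q ∧ 0 ≤ τ ∧ 0 < ν₀ ∧ 0 < δ ∧ ∀ (ν : ℝ) (V : UnitAddTorus (Fin 3) → EuclideanSpace ℝ (Fin 3)) (u : ℝ → UnitAddTorus (Fin 3) → EuclideanSpace ℝ (Fin 3)), 0 < ν → ν < ν₀ → Literature.Analysis.FunctionSpaces.Torus.IsSmooth V → Literature.Analysis.FunctionSpaces.Torus.IsDivFree V → MeasureTheory.eLpNorm (V - U₀) 2 MeasureTheory.volume ≤ ENNReal.ofReal δ → Literature.Analysis.FluidPDE.Torus.IsGlobalLerayHopf ν (fun _ => f) V u → q ≤ ν * (MeasureTheory.lintegral (MeasureTheory.Measure.restrict MeasureTheory.volume (Set.Ioo 0 (S + τ))) (fun t => Literature.Analysis.FunctionSpaces.Torus.eGradNormSq (u t))).toReal := by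
  sorry

/-! ## Name-keyed aliases of the stub statements (hypotheses of `SingularitiesDissipate_of`; device of `Lines/birth.lean`) -/
namespace __Registered

/-- Alias of the statement of `stub_blowupIsL2Open`, keyed by the stub name. -/
abbrev stub_blowupIsL2Open : Prop :=
  ∀ f : UnitAddTorus (Fin 3) → EuclideanSpace ℝ (Fin 3), Literature.Analysis.FunctionSpaces.Torus.IsSmooth f → Literature.Analysis.FunctionSpaces.Torus.IsDivFree f → Literature.Analysis.FunctionSpaces.Torus.HasZeroMean f → ∀ (U₀ : UnitAddTorus (Fin 3) → EuclideanSpace ℝ (Fin 3)), Literature.Analysis.FunctionSpaces.Torus.IsSmooth U₀ → Literature.Analysis.FunctionSpaces.Torus.IsDivFree U₀ → ∀ (T : ℝ), 0 < T → (∀ (U : ℝ → UnitAddTorus (Fin 3) → EuclideanSpace ℝ (Fin 3)) (P : ℝ → UnitAddTorus (Fin 3) → ℝ), Literature.Analysis.FunctionSpaces.Torus.IsClassicalNSSolutionOn (Set.Icc 0 T) 0 (fun _ => f) U P → U 0 ≠ U₀) → ∃ (τ r : ℝ), 0 ≤ τ ∧ 0 < r ∧ ∀ (V : UnitAddTorus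 (Fin 3) → EuclideanSpace ℝ (Fin 3)), Literature.Analysis.FunctionSpaces.Torus.IsSmooth V → Literature.Analysis.FunctionSpaces.Torus.IsDivFree V → MeasureTheory.eLpNorm (V - U₀) 2 MeasureTheory.volume ≤ ENNReal.ofReal r → ∀ (U : ℝ → UnitAddTorus (Fin 3) → EuclideanSpace ℝ (Fin 3)) (P : ℝ → UnitAddTorus (Fin 3) → ℝ), Literature.Analysis.FunctionSpaces.Torus.IsClassicalNSSolutionOn (Set.Icc 0 (T + τ)) 0 (fun _ => f) U P → U 0 ≠ V

/-- Alias of the statement of `stub_regularRestart`, keyed by the stub name. -/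
abbrev stub_regularRestart : Prop :=
  ∀ (ν : ℝ), 0 < ν → ∀ f : UnitAddTorus (Fin 3) → EuclideanSpace ℝ (Fin 3), Literature.Analysis.FunctionSpaces.Torus.IsSmooth f → Literature.Analysis.FunctionSpaces.Torus.IsDivFree f → Literature.Analysis.FunctionSpaces.Torus.HasZeroMean f → ∀ (u₀ : UnitAddTorus (Fin 3) → EuclideanSpace ℝ (Fin 3)) (u : ℝ → UnitAddTorus (Fin 3) → EuclideanSpace ℝ (Fin 3)), Literature.Analysis.FluidPDE.Torus.IsGlobalLerayHopf ν (fun _ => f) u₀ u → MeasureTheory.MemLp u₀ 2 MeasureTheory.volume → ∀ (s₀ ε : ℝ), 0 < s₀ → 0 < ε → ∃ (s : ℝ) (V : UnitAddTorus (Fin 3) → EuclideanSpace ℝ (Fin 3)), 0 < s ∧ s < s₀ ∧ Literature.Analysis.FunctionSpaces.Torus.IsSmooth V ∧ Literature.Analysis.FunctionSpaces.Torus.IsDivFree V ∧ MeasureTheory.eLpNorm (V - u₀) 2 MeasureTheory.volume ≤ ENNReal.ofReal ε ∧ Literature.Analysis.FluidPDE.Torus.IsGlobalLerayHopf ν (fun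 _ => f) V (fun t => u (s + t))

/-- Alias of the statement of `stub_smoothBallIgnition`, keyed by the stub name. -/
abbrev stub_smoothBallIgnition : Prop :=
  ∀ f : UnitAddTorus (Fin 3) → EuclideanSpace ℝ (Fin 3), Literature.Analysis.FunctionSpaces.Torus.IsSmooth f → Literature.Analysis.FunctionSpaces.Torus.IsDivFree f → Literature.Analysis.FunctionSpaces.Torus.HasZeroMean f → ∀ (U₀ : UnitAddTorus (Fin 3) → EuclideanSpace ℝ (Fin 3)), Literature.Analysis.FunctionSpaces.Torus.IsSmooth U₀ → Literature.Analysis.FunctionSpaces.Torus.IsDivFree U₀ → ∀ (r S : ℝ), 0 < r → 0 < S → (∀ (V : UnitAddTorus (Fin 3) → EuclideanSpace ℝ (Fin 3)), Literature.Analysis.FunctionSpaces.Torus.IsSmooth V → Literature.Analysis.FunctionSpaces.Torus.IsDivFree V → MeasureTheory.eLpNorm (V - U₀) 2 MeasureTheory.volume ≤ ENNReal.ofReal r → ∀ (U : ℝ → UnitAddTorus (Fin 3) → EuclideanSpace ℝ (Fin 3)) (P : ℝ → UnitAddTorus (Fin 3) → ℝ), Literature.Analysis.FunctionSpaces.Torus.IsClassicalNSSolutionOn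 (Set.Icc 0 S) 0 (fun _ => f) U P → U 0 ≠ V) → ∃ (q τ ν₀ δ : ℝ), 0 < q ∧ 0 ≤ τ ∧ 0 < ν₀ ∧ 0 < δ ∧ ∀ (ν : ℝ) (V : UnitAddTorus (Fin 3) → EuclideanSpace ℝ (Fin 3)) (u : ℝ → UnitAddTorus (Fin 3) → EuclideanSpace ℝ (Fin 3)), 0 < ν → ν < ν₀ → Literature.Analysis.FunctionSpaces.Torus.IsSmooth V → Literature.Analysis.FunctionSpaces.Torus.IsDivFree V → MeasureTheory.eLpNorm (V - U₀) 2 MeasureTheory.volume ≤ ENNReal.ofReal δ → Literature.Analysis.FluidPDE.Torus.IsGlobalLerayHopf ν (fun _ => f) V u → q ≤ ν * (MeasureTheory.lintegral (MeasureTheory.Measure.restrict MeasureTheory.volume (Set.Ioo 0 (S + τ))) (fun t => Literature.Analysis.FunctionSpaces.Torus.eGradNormSq (u t))).toReal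

end __Registered

/-- Translation of the dissipation window: `∫_{(0,L)} g (s + t) dt = ∫_{(s, s+L)} g t dt` for the Lebesgue measure
(translation invariance; Mathlib `MeasurePreserving.setLIntegral_comp_emb` with `Set.image_const_add_Ioo`). [bookkeeping] -/
theorem setLIntegral_Ioo_comp_add_left (g : ℝ → ENNReal) (s L : ℝ) :
    (∫⁻ t in Set.Ioo 0 L, g (s + t)) = ∫⁻ t in Set.Ioo s (s + L), g t := by
  have h := (measurePreserving_add_left (volume : Measure ℝ) s).setLIntegral_comp_emb
    (measurableEmbedding_addLeft s) g (Set.Ioo 0 L)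
  rw [h, Set.image_const_add_Ioo, add_zero]

/-- **Composition** (kernel-checked, no `sorry` of its own): the three stub statements (as the name-keyed aliases) imply
the crux `Sparks.SingularitiesDissipate` BY NAME. See the module docstring for the map; witnesses `(q, τ₁+τ₂+1, ν₀, δ/2)`.
[bookkeeping] -/
theorem SingularitiesDissipate_of :
    __Registered.stub_blowupIsL2Open → __Registered.stub_regularRestart → __Registered.stub_smoothBallIgnition →
      Summit.AnomalousDissipation.AnomalousDissipation.Theses.Sparks.SingularitiesDissipate := by
  intro hOpen hRestart hBall
  dsimp only [__Registered.stub_blowupIsL2Open, __Registered.stub_regularRestart,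
    __Registered.stub_smoothBallIgnition] at hOpen hRestart hBall
  unfold Summit.AnomalousDissipation.AnomalousDissipation.Theses.Sparks.SingularitiesDissipate
  intro f hf hfd hfm U₀ hU₀ hU₀d T hT hbreak
  -- stub 1: the blow-up ball `B_r(U₀)` with delay `τ₁`
  obtain ⟨τ₁, r, hτ₁, hr, hball⟩ := hOpen f hf hfd hfm U₀ hU₀ hU₀d T hT hbreak
  -- stub 3 on the window `S := T + τ₁`: ignition for SMOOTH data in `B_δ(U₀)`
  have hS : 0 < T + τ₁ := by linarith
  obtain ⟨q, τ₂, ν₀, δ, hq, hτ₂, hν₀, hδ, hign⟩ := hBall f hf hfd hfm U₀ hU₀ hU₀d r (T + τ₁) hr hS hball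
  refine ⟨q, τ₁ + τ₂ + 1, ν₀, δ / 2, hq, by linarith, hν₀, by positivity, ?_⟩
  intro ν u₀ u hν hνlt hLH hmem hclose
  -- stub 2: restart at a regular time `s ∈ (0, 1)` from a smooth representative `V`, `δ/2`-close to `u₀`
  obtain ⟨s, V, hs0, hs1, hV, hVd, hVu₀, hLH'⟩ :=
    hRestart ν hν f hf hfd hfm u₀ u hLH hmem 1 (δ / 2) one_pos (by positivity)
  -- `V` is `δ`-close to `U₀` (triangle inequality in `L²`)
  have hVmeas : AEStronglyMeasurable (V - u₀) volume :=
    (hV.memLp 2).aestronglyMeasurable.sub hmem.aestronglyMeasurable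
  have hu₀meas : AEStronglyMeasurable (u₀ - U₀) volume :=
    hmem.aestronglyMeasurable.sub (hU₀.memLp 2).aestronglyMeasurable
  have hVU₀ : MeasureTheory.eLpNorm (V - U₀) 2 MeasureTheory.volume ≤ ENNReal.ofReal δ := by
    have hsplit : V - U₀ = (V - u₀) + (u₀ - U₀) := by abel
    calc MeasureTheory.eLpNorm (V - U₀) 2 MeasureTheory.volume
        = MeasureTheory.eLpNorm ((V - u₀) + (u₀ - U₀)) 2 MeasureTheory.volume := by rw [hsplit]
      _ ≤ MeasureTheory.eLpNorm (V - u₀) 2 MeasureTheory.volume + MeasureTheory.eLpNorm (u₀ - U₀) 2 MeasureTheory.volume :=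
          eLpNorm_add_le hVmeas hu₀meas (by norm_num)
      _ ≤ ENNReal.ofReal (δ / 2) + ENNReal.ofReal (δ / 2) := add_le_add hVu₀ hclose
      _ = ENNReal.ofReal δ := by
          rw [← ENNReal.ofReal_add (by positivity) (by positivity)]; congr 1; ring
  -- ignition of the restarted solution, then translate and enlarge the window
  have hburn := hign ν V (fun t => u (s + t)) hν hνlt hV hVd hVU₀ hLH'
  have htrans : (∫⁻ t in Set.Ioo 0 (T + τ₁ + τ₂), Literature.Analysis.FunctionSpaces.Torus.eGradNormSq (u (s + t))) =
      ∫⁻ t in Set.Ioo s (s + (T + τ₁ + τ₂)), Literature.Analysis.FunctionSpaces.Torus.eGradNormSq (u t) :=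
    setLIntegral_Ioo_comp_add_left (fun t => Literature.Analysis.FunctionSpaces.Torus.eGradNormSq (u t)) s (T + τ₁ + τ₂)
  have hW : 0 < T + (τ₁ + τ₂ + 1) := by linarith
  have hfin : (∫⁻ t in Set.Ioo 0 (T + (τ₁ + τ₂ + 1)), Literature.Analysis.FunctionSpaces.Torus.eGradNormSq (u t)) ≠ ⊤ :=
    ((hLH.isLerayHopfOn hW).lintegral_eGradNormSq_lt_top).ne
  have hsub : Set.Ioo s (s + (T + τ₁ + τ₂)) ⊆ Set.Ioo 0 (T + (τ₁ + τ₂ + 1)) :=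
    Set.Ioo_subset_Ioo hs0.le (by linarith)
  have hmono : (∫⁻ t in Set.Ioo 0 (T + τ₁ + τ₂), Literature.Analysis.FunctionSpaces.Torus.eGradNormSq (u (s + t))).toReal ≤
      (∫⁻ t in Set.Ioo 0 (T + (τ₁ + τ₂ + 1)), Literature.Analysis.FunctionSpaces.Torus.eGradNormSq (u t)).toReal := by
    rw [htrans]
    exact ENNReal.toReal_mono hfin (MeasureTheory.lintegral_mono_set hsub)
  have hνB := mul_le_mul_of_nonneg_left hmono hν.le
  exact hburn.trans hνB

/-- **The skeleton in its final shape**: the crux BY NAME from the three stubs through the sorry-free composition (depends on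
`sorryAx` only through the stubs). -/
theorem SingularitiesDissipate_skeleton :
    Summit.AnomalousDissipation.AnomalousDissipation.Theses.Sparks.SingularitiesDissipate :=
  SingularitiesDissipate_of stub_blowupIsL2Open stub_regularRestart stub_smoothBallIgnition

end Summit.AnomalousDissipation.AnomalousDissipation.Cruxes.SingularitiesDissipate.Robust

end
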